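import Summits.RiemannHypothesis.RiemannHypothesis.Theorems.JensenPolynomialsFarGumbelDefs
import Summits.RiemannHypothesis.RiemannHypothesis.Theorems.JensenPolynomialsWindowEGFIntegralRepr

/-!
# Route `JensenPolynomials`, FAR crux `XiWindowZeroFreeRelFar` (B1-rel far) — stub S1 `stub_integralRepr` of the line
«far-gumbel» (RH-FREE; cell rh-jensen, HUMAN RULING D-0040)

Theory g8's registered skeleton v3 (sha16 `69a41b651df70375`, item `stmt-RiemannHypothesis-19465`) names as stub S1 the
kernel-integral representation `μ_{2M}·F_M(s) = winI M s`, where `winI` (`Theorems/JensenPolynomialsFarGumbelDefs.lean`) is by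
definition the right side of theory g7's identity `WindowEGF.integralRepr` (`Theorems/JensenPolynomialsWindowEGFIntegralRepr.lean`,
p440252). This file proves the registered signature BY NAME: it is `WindowEGF.integralRepr` after unfolding `winI`.
WHAT THIS IS NOT: an identity between explicit numbers attached to `ξ`'s Taylor data and the kernel `Φ`; nothing here bears on
the zeros of `ζ` or the truth of RH.
-/

noncomputable section
-- D-0017: `Summit.RiemannHypothesis.RiemannHypothesis.…` duplicates the namespace BY DESIGN (single-problem summit).
set_option linter.dupNamespace false

namespace Summit.RiemannHypothesis.RiemannHypothesis.Theorems.JensenPolynomials.FarGumbel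

open Summit.RiemannHypothesis.RiemannHypothesis.Theorems.JensenPolynomials
open Literature.NumberTheory.LFunctions MeasureTheory

/-- **stub S1 of the line «far-gumbel» (registered signature, verbatim): the kernel-integral representation
`μ_{2M}·F_M(s) = I(M,s)`** — `WindowEGF.integralRepr` (theory g7) with `winI` unfolded. -/
theorem stub_integralRepr : ∀ M : ℕ, 1 ≤ M → ∀ s : ℂ,
      (1 + ∑ k ∈ Finset.Icc 1 M, (((windowSeqDown xiTaylorCoeff M k / (Nat.factorial k : ℝ) : ℝ)) : ℂ) * s ^ k) *
          ((xiMoment (2 * M) : ℝ) : ℂ) = winI M s := by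
  intro M hM s
  rw [winI]
  exact WindowEGF.integralRepr M hM s

end Summit.RiemannHypothesis.RiemannHypothesis.Theorems.JensenPolynomials.FarGumbel

end
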